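import Mathlib.Topology.Instances.ZMod
import Mathlib.LinearAlgebra.Matrix.Permutation
import Literature.NumberTheory.GaloisRepresentations.ModPGaloisRep
import Literature.NumberTheory.GaloisRepresentations.CartanNormalizerCriterionGaloisImage
import Literature.NumberTheory.GaloisRepresentations.AbsGaloisOuterConj
import Literature.NumberTheory.GaloisRepresentations.ArtinLFunction
import Literature.NumberTheory.GaloisRepresentations.HeckeCharacterProofs
import Literature.NumberTheory.Automorphic.ChebotarevArtinRepHolds
import Literature.NumberTheory.Automorphic.QuadraticCharacterTwist
import HarnessLib

/-!
# Caraiani–Newton, Lemma 6.2.2: over a quadratic field, `ρ̄|_{G_{F(ζ_p)}}` absolutely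
# irreducible implies `ρ̄` decomposed generic (PROVED)

Topic `Literature/NumberTheory/GaloisRepresentations`; theorems only (no definitions, no named
facts).  A. Caraiani, J. Newton, *On the modularity of elliptic curves over imaginary quadratic
fields*, arXiv:2301.10509v3 [CaraianiNewton2023], §6.2, Lemma 6.2.2 (p. 90, proof pp. 90–91):

> *Let `F/ℚ` be a quadratic field, let `p` be an odd prime, and let `ρ̄ : G_F → GL₂(𝔽_p)` be a
> homomorphism. Suppose that `ρ̄|_{G_{F(ζ_p)}}` is absolutely irreducible. Then `ρ̄` is decomposed
> generic.*

This is the lemma that upgrades Cor. 6.1.1 of the source (modularity of elliptic curves over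
imaginary quadratic fields under a residual irreducibility hypothesis at `3` or `5`) from its
Theorem 6.1 (which asks in addition that `r̄_{E,p}` be decomposed generic); it is hypothesis (L) of
`Literature.NumberTheory.Automorphic.CaraianiNewton2023_cor611_nonCM_printed_of_thm61_of_lemma622`
(`Automorphic/CaraianiNewtonResidualImageModularity`), stated there — and proved here — for
continuous `ρ̄ : Γ_F →ₜ* GL₂(𝔽_p)` (`ModPGaloisRep`), with "`ρ̄|_{G_{F(ζ_p)}}` absolutely
irreducible" rendered as in `ModPImageAbsIrreducibleOverCyclotomic` (every model `L` of `F(ζ_p)`,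
`FramedGaloisRep.restrictField L ρ̄`, `FramedRep.IsAbsolutelyIrreducible`) and "decomposed generic"
as in [ACC⁺23, Def. 4.3.1] (`IsDecomposedGeneric`, file `DecomposedGeneric`).

## The printed proof and its formalization

Printed proof (pp. 90–91).  Let `P = Proj ρ̄`, `L = F̄^{ker P}`, `L₁ = L(ζ_p)`, `L̃`, `L̃₁ = L̃(ζ_p)`
the Galois closures over `ℚ`, `c ∈ Gal(L̃/ℚ)` a lift of the non-trivial element of `Gal(F/ℚ)`.
Then `σ ↦ (σ|_{L₁}, (c⁻¹σc)|_{L₁})` embeds `Gal(L̃₁/F(ζ_p))` into `Gal(L₁/F(ζ_p))²` with both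
projections onto; by Dickson / [Ser72, Prop. 15] the group `Gal(L₁/F(ζ_p)) ⊇ Pρ̄(G_{F(ζ_p)})`
has a non-identity element of order prime to `p`; Goursat's lemma then gives
`τ ∈ Gal(L̃₁/F(ζ_p))` both of whose projections are non-identity of order prime to `p`; Chebotarev
gives a rational prime `l` unramified in `L̃₁` with `Frob_l = [τ]`; as `τ` fixes `F(ζ_p)`,
`l ≡ 1 mod p` and `l` splits in `F`, the Frobenius elements at `v ∣ l` in `G_F` being the
conjugates of `τ` and `c⁻¹τc`; `ρ̄(τ)` and `ρ̄(c⁻¹τc)` are regular semisimple, so `l` is decomposed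
generic for `ρ̄`.

Formalization (same architecture, no fixed fields).
* The **group theory** is the tree's
  `CaraianiNewton.exists_disc_ne_zero_and_disc_apply_ne_zero`
  (`CartanNormalizerCriterionGaloisImage`): for `ρ̄ : Γ →* GL₂(𝔽_p)`, an endomorphism `θ` of `Γ`
  and `Γ₁ ≤ Γ` with `θ(Γ₁) = Γ₁` on which `ρ̄` is irreducible, some `τ ∈ Γ₁` has `ρ̄(τ)`,
  `ρ̄(θτ)` regular semisimple.  Here `Γ = Γ_F`, `Γ₁ = Γ_{F(ζ_p)}`
  (`absGaloisGroupAdjoinRootsOfUnity F p`, which is the image of `Γ_L → Γ_F` for every model `L`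
  of `F(ζ_p)`: `range_absGaloisRestrict_eq_absGaloisGroupAdjoinRootsOfUnity`, whence irreducibility
  on `Γ₁`, `isIrreducible_glRepresentation_of_range_le`), and `θ = θ_c` is the outer conjugation
  `res⁻¹(c · res(·) · c⁻¹)` of `Γ_F` by `c ∈ Γ_ℚ ∖ res(Γ_F)` along `res : Γ_F ↪ Γ_ℚ`
  (`absGaloisOuterConj`, file `AbsGaloisOuterConj`), which preserves `Γ₁`
  (`map_absGaloisOuterConj_absGaloisGroupAdjoinRootsOfUnity`).
* **Chebotarev** is the tree's proved existence form for Artin representations,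
  `Literature.NumberTheory.Automorphic.chebotarev_artinRep_holds`, applied over `ℚ` to a faithful
  Artin representation `S` of `Γ_ℚ/N` (`exists_framedArtinRep_ker_eq`) for an open normal subgroup
  `N ⊆ res(ker ρ̄ ∩ Γ₁)` (Mathlib `ProfiniteGrp.exist_openNormalSubgroup_sub_open_nhds_of_one`;
  `res` is an open embedding, `isOpenMap_absGaloisRestrict_of_isOpen_range`), at `g = res τ`: this
  yields a place `v` of `ℚ` — chosen unramified in `F` and prime to `p` (finitely many exceptions,
  `finite_setOf_not_isUnramifiedIn`) — with `S` unramified at `v` and a Frobenius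
  `Φ ≡ res τ (mod N)` at a prime `𝔓₀ ∣ v` of `\bar ℤ`.
* **Conclusion.**  `Φ` fixes the `p`-th roots of unity, so `l = q_v ≡ 1 (mod p)`
  (`residueCard_modEq_one_of_isArithFrobAt_of_mem`, via Mathlib
  `IsArithFrobAt.apply_of_pow_eq_one`); `Φ ∈ res(Γ_F)`, so the places of `F` above `l` have residue
  degree `1` (`exists_places_split_of_mem_range`, file `FrobeniusPlaces`) and `l` splits
  completely (`Rat.isUnramifiedIn_int_of_isUnramifiedIn`: unramified over `𝓞 ℚ` ⟹ over `ℤ`, by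
  Mathlib `Ideal.ramificationIdx_tower`); inertia at `w ∣ l` restricts into inertia over `ℚ`,
  killed by `S`, hence lies in `N ⊆ res(ker ρ̄)`; and a Frobenius `φ` at a prime above `w ∣ l`
  restricts to a Frobenius over `ℚ`, which is `≡ γ Φ γ⁻¹ ≡ γ (res τ) γ⁻¹ (mod N)` for some
  `γ ∈ Γ_ℚ = res(Γ_F) ⊔ c · res(Γ_F)` — so `ρ̄(φ)` is conjugate to `ρ̄(τ)` or to `ρ̄(θτ)`, and its
  eigenvalues are distinct with ratio `≠ 1 = l` in `𝔽̄_p`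
  (`CaraianiNewton.nodup_eigenvalueMultiset_of_disc_ne_zero`, `eigenvalueMultiset_conj`).

## References

* [CaraianiNewton2023] A. Caraiani, J. Newton, arXiv:2301.10509v3, §6.2, Lemma 6.2.2 and its proof
  (pp. 90–91); read 2026-08-16 from the held arXiv text (`lit read arxiv:2301.10509`).
* [ACCGHLNSTT2023] P. Allen et al., *Potential automorphy over CM fields*, Ann. of Math. 197 (2023),
  Def. 4.3.1 (decomposed generic) — through `DecomposedGeneric`.
* J.-P. Serre, *Propriétés galoisiennes des points d'ordre fini des courbes elliptiques*, Invent.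
  Math. 15 (1972), Prop. 15 — through `CartanNormalizerCriterionGL2Fp`.
* J. Tate, *Global class field theory*, in Cassels–Fröhlich (1967), Ch. VII §2.4 (Chebotarev) —
  through `Automorphic/ChebotarevArtinRepHolds`.
-/

noncomputable section

open scoped NumberField Pointwise MatrixGroups Topology
open Field IsDedekindDomain NumberField Rat.HeightOneSpectrum

namespace Literature.NumberTheory.GaloisRepresentations

universe u w

/-! ### Irreducibility only depends on the image -/

section S1

variable {Γ : Type*} [Group Γ] {Γ' : Type*} [Group Γ'] {k : Type w} [Field k] {n : ℕ}

/-- If `τ : Γ' →* GL_n(k)` is irreducible (Mathlib `Representation.IsIrreducible` of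
`glRepresentation τ`) and `τ(Γ') ⊆ σ(Γ)`, then `σ` is irreducible. [folklore] -/
theorem isIrreducible_glRepresentation_of_range_le {τ : Γ' →* GL (Fin n) k}
    {σ : Γ →* GL (Fin n) k} (hτ : (glRepresentation τ).IsIrreducible) (h : τ.range ≤ σ.range) :
    (glRepresentation σ).IsIrreducible := by
  set T := glRepresentation τ with hTdef
  set R := glRepresentation σ with hRdef
  have stable : ∀ (W : Subrepresentation R) (g' : Γ') ⦃v : Fin n → k⦄,
      v ∈ W.toSubmodule → T g' v ∈ W.toSubmodule := by
    intro W g' v hv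
    obtain ⟨g, hg⟩ := h ⟨g', rfl⟩
    have e : T g' v = R g v := by
      simp only [hTdef, hRdef, glRepresentation_apply_apply, hg]
    rw [e]
    exact W.apply_mem_toSubmodule g hv
  haveI := hτ
  have hbotT : (⊥ : Subrepresentation T).toSubmodule = ⊥ := rfl
  have htopT : (⊤ : Subrepresentation T).toSubmodule = ⊤ := rfl
  have hbotR : (⊥ : Subrepresentation R).toSubmodule = ⊥ := rfl
  have htopR : (⊤ : Subrepresentation R).toSubmodule = ⊤ := rfl
  refine { toNontrivial := ⟨⟨⊥, ⊤, fun hbt ↦ ?_⟩⟩, eq_bot_or_eq_top := fun W ↦ ?_ }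
  · apply (bot_ne_top : (⊥ : Subrepresentation T) ≠ ⊤)
    apply Subrepresentation.toSubmodule_injective
    rw [hbotT, htopT, ← hbotR, ← htopR, hbt]
  · let W' : Subrepresentation T := ⟨W.toSubmodule, stable W⟩
    have hW' : W'.toSubmodule = W.toSubmodule := rfl
    rcases eq_bot_or_eq_top W' with h0 | h1
    · refine Or.inl (Subrepresentation.toSubmodule_injective ?_)
      rw [hbotR, ← hbotT, ← h0, hW']
    · refine Or.inr (Subrepresentation.toSubmodule_injective ?_)
      rw [htopR, ← htopT, ← h1, hW']

/-- Absolute irreducibility implies irreducibility (take `f = id`). [folklore] -/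
theorem IsAbsIrreducible.isIrreducible {σ : Γ →* GL (Fin n) k} (h : IsAbsIrreducible σ) :
    (glRepresentation σ).IsIrreducible := by
  have h1 := h k (RingHom.id k)
  have e : (Matrix.GeneralLinearGroup.map (RingHom.id k)).comp σ = σ := by
    ext g i j
    simp
  rwa [e] at h1

end S1

/-! ### The image of `Γ_L → Γ_F` for a model `L` of `F(ζ_p)` is `Γ_{F(ζ_p)}` -/

section S2

variable (F : Type u) [Field F] (L : Type u) [Field L] [Algebra F L] (p : ℕ) [Fact p.Prime]

/-- **`res(Γ_L) = Γ_{F(ζ_p)}`** for any model `L ⊇ F` of `F(ζ_p)` (`IsCyclotomicExtension {p} F L`,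
`char F = 0`): an element of `Γ_F` comes from `Γ_L` iff it fixes the copy `e(L) ⊆ F̄`
(`mem_range_absGaloisRestrict_iff_smul_absEmbedding`) iff it fixes every `p`-th root of unity of
`F̄` (`L = F(ζ)`, and the `p`-th roots of unity of `F̄` are the powers of `e(ζ)`), i.e. iff it
lies in `absGaloisGroupAdjoinRootsOfUnity F p`. [folklore] -/
theorem range_absGaloisRestrict_eq_absGaloisGroupAdjoinRootsOfUnity [CharZero F]
    [IsCyclotomicExtension {p} F L] :
    (absGaloisRestrict F L).range = absGaloisGroupAdjoinRootsOfUnity F p := by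
  have hp : (p : ℕ) ≠ 0 := (Fact.out : p.Prime).ne_zero
  haveI : NeZero p := ⟨hp⟩
  haveI : Algebra.IsAlgebraic F L :=
    (IsCyclotomicExtension.integral {p} F L).isAlgebraic  -- guess
  obtain ⟨ζ, hζ⟩ : ∃ ζ : L, IsPrimitiveRoot ζ p :=
    IsCyclotomicExtension.exists_isPrimitiveRoot F L (Set.mem_singleton p) hp
  set e := absEmbedding F L with he
  have heζ : IsPrimitiveRoot (e ζ) p := hζ.map_of_injective e.toRingHom.injective
  ext g
  rw [mem_range_absGaloisRestrict_iff_smul_absEmbedding, mem_absGaloisGroupAdjoinRootsOfUnity_iff]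
  constructor
  · intro hg x hx
    obtain ⟨i, -, rfl⟩ := heζ.eq_pow_of_pow_eq_one hx
    rw [smul_pow', hg ζ]
  · intro hg y
    have hy : y ∈ Algebra.adjoin F {b : L | ∃ n ∈ ({p} : Set ℕ), n ≠ 0 ∧ b ^ n = 1} :=
      IsCyclotomicExtension.adjoin_roots (S := {p}) (A := F) (B := L) y
    induction hy using Algebra.adjoin_induction with
    | mem b hb =>
      obtain ⟨n, hn, -, hbn⟩ := hb
      rw [Set.mem_singleton_iff] at hn
      subst hn
      exact hg (e b) (by rw [← map_pow, hbn, map_one])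
    | algebraMap r =>
      rw [AlgHom.commutes, absoluteGaloisGroup.smul_def, AlgEquiv.commutes]
    | add x y _ _ hx hy => rw [map_add, smul_add, hx, hy]
    | mul x y _ _ hx hy => rw [map_mul, smul_mul', hx, hy]

end S2

/-! ### `Γ_{K(ζ_p)}` under restriction to a subfield and under the outer action -/

section S3

variable (K : Type u) [Field K] (M : Type u) [Field M] [Algebra K M] (p : ℕ)

/-- `Γ_{K(ζ_p)}` is a normal subgroup of `Γ_K` (its elements are those fixing the set of `p`-th
roots of unity of `K̄`, which `Γ_K` permutes). [folklore] -/
theorem normal_absGaloisGroupAdjoinRootsOfUnity :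
    (absGaloisGroupAdjoinRootsOfUnity K p).Normal := by
  refine ⟨fun g hg h ↦ ?_⟩
  rw [mem_absGaloisGroupAdjoinRootsOfUnity_iff] at hg ⊢
  intro x hx
  have hx' : (h⁻¹ • x) ^ p = 1 := by rw [← smul_pow', hx, smul_one]
  rw [mul_smul, mul_smul, hg _ hx', smul_inv_smul]

variable [Algebra.IsAlgebraic K M]

/-- **`σ ∈ Γ_{M(ζ_p)}` iff `res(σ) ∈ Γ_{K(ζ_p)}`** for an algebraic extension `M/K` and the
restriction `res : Γ_M → Γ_K` (the chosen `ι : K̄ → M̄` is a bijection carrying the `p`-th roots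
of unity of `K̄` onto those of `M̄`, and `ι(res σ • x) = σ • ι x`). [folklore] -/
theorem mem_absGaloisGroupAdjoinRootsOfUnity_iff_absGaloisRestrict (σ : absoluteGaloisGroup M) :
    σ ∈ absGaloisGroupAdjoinRootsOfUnity M p ↔
      absGaloisRestrict K M σ ∈ absGaloisGroupAdjoinRootsOfUnity K p := by
  have hbij := absClosureEmbedding_bijective K M
  set ι := absClosureEmbedding K M with hι
  rw [mem_absGaloisGroupAdjoinRootsOfUnity_iff, mem_absGaloisGroupAdjoinRootsOfUnity_iff]
  constructor
  · intro h x hx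
    apply hbij.1
    rw [absGaloisRestrict_apply_smul]
    exact h _ (by rw [← map_pow, hx, map_one])
  · intro h y hy
    obtain ⟨x, rfl⟩ := hbij.2 y
    have hx : x ^ p = 1 := hbij.1 (by rw [map_pow, hy, map_one])
    rw [← absGaloisRestrict_apply_smul, h x hx]

variable [IsGalois K M] [CharZero M]

/-- **The outer action of `Γ_K` on `Γ_M` preserves `Γ_{M(ζ_p)}`**: for `M/K` Galois and
`c ∈ Γ_K`, `θ_c(Γ_{M(ζ_p)}) = Γ_{M(ζ_p)}` (`θ_c = res⁻¹(c · res(·) · c⁻¹)`, and `Γ_{K(ζ_p)}` is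
normal in `Γ_K`).  In Caraiani–Newton, Lemma 6.2.2: `K = ℚ`, `M = F` quadratic, `c` a lift of
the non-trivial element of `Gal(F/ℚ)`, "`c⁻¹ σ c`". [folklore] -/
theorem map_absGaloisOuterConj_absGaloisGroupAdjoinRootsOfUnity (c : absoluteGaloisGroup K) :
    (absGaloisGroupAdjoinRootsOfUnity M p).map (absGaloisOuterConj K M c).toMonoidHom =
      absGaloisGroupAdjoinRootsOfUnity M p := by
  have key : ∀ (c : absoluteGaloisGroup K) (σ : absoluteGaloisGroup M),
      σ ∈ absGaloisGroupAdjoinRootsOfUnity M p →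
        absGaloisOuterConj K M c σ ∈ absGaloisGroupAdjoinRootsOfUnity M p := by
    intro c σ hσ
    rw [mem_absGaloisGroupAdjoinRootsOfUnity_iff_absGaloisRestrict K M p] at hσ ⊢
    rw [absGaloisRestrict_absGaloisOuterConj]
    exact (normal_absGaloisGroupAdjoinRootsOfUnity K p).conj_mem _ hσ c
  ext τ
  constructor
  · rintro ⟨σ, hσ, rfl⟩
    exact key c σ hσ
  · intro hτ
    exact ⟨absGaloisOuterConj K M c⁻¹ τ, key c⁻¹ τ hτ,
      absGaloisOuterConj_apply_inv_apply K M c τ⟩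

end S3


/-! ### Openness; a faithful Artin representation of `Γ_K / N` -/

section S4

variable (K : Type u) [Field K] (p : ℕ)

/-- `Γ_{K(ζ_p)}` is open in `Γ_K` (`0 < p`): it is the fixing subgroup of the finite extension
`K(μ_p)` of `K` inside `K̄` (finitely many `p`-th roots of unity, all algebraic; Mathlib
`IntermediateField.fixingSubgroup_isOpen`). [folklore] -/
theorem isOpen_absGaloisGroupAdjoinRootsOfUnity (hp : 0 < p) :
    IsOpen (absGaloisGroupAdjoinRootsOfUnity K p : Set (absoluteGaloisGroup K)) := by
  classical
  have hfin : {x : AlgebraicClosure K | x ^ p = 1}.Finite := by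
    refine (Polynomial.nthRoots p (1 : AlgebraicClosure K)).toFinset.finite_toSet.subset ?_
    intro x hx
    simp only [Set.mem_setOf_eq] at hx
    simp only [Finset.mem_coe, Multiset.mem_toFinset, Polynomial.mem_nthRoots hp, hx]
  haveI : Finite {x : AlgebraicClosure K | x ^ p = 1} := hfin.to_subtype
  haveI : FiniteDimensional K
      (IntermediateField.adjoin K {x : AlgebraicClosure K | x ^ p = 1}) :=
    IntermediateField.finiteDimensional_adjoin fun x _ ↦ Algebra.IsIntegral.isIntegral x
  exact IntermediateField.fixingSubgroup_isOpen _

variable (M : Type u) [Field M] [Algebra K M]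

/-- If `res : Γ_M → Γ_K` has open image (e.g. `M/K` finite), it is an open map (`res` is a closed
embedding, `isClosedEmbedding_absGaloisRestrict`). [folklore] -/
theorem isOpenMap_absGaloisRestrict_of_isOpen_range [CharZero M] [Algebra.IsAlgebraic K M]
    (h : IsOpen (((absGaloisRestrict K M).range : Subgroup (absoluteGaloisGroup K)) :
      Set (absoluteGaloisGroup K))) :
    IsOpenMap (absGaloisRestrict K M) := by
  have hr : IsOpen (Set.range (absGaloisRestrict K M)) := by
    convert h using 1
    ext; simp
  exact (Topology.IsOpenEmbedding.mk (isClosedEmbedding_absGaloisRestrict K M).isEmbedding hr).isOpenMap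

variable {K}

/-- **A faithful Artin representation of `Γ_K / N` for an open normal subgroup `N`**: there is a
continuous `S : Γ_K → GL_m(ℂ)` with `ker S = N` — the regular permutation representation of the
finite group `Γ_K / N` (Mathlib `MulAction.toPermHom`, `Matrix.permMatrixHom`), continuous
because it is trivial on the open subgroup `N`. [folklore] -/
theorem exists_framedArtinRep_ker_eq [CharZero K] (N : OpenNormalSubgroup (absoluteGaloisGroup K)) :
    ∃ (m : ℕ) (S : FramedArtinRep K m),
      (S : absoluteGaloisGroup K →* GL (Fin m) ℂ).ker = N.toSubgroup := by
  classical
  set G := absoluteGaloisGroup K ⧸ N.toSubgroup with hG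
  haveI : Finite G := inferInstance
  letI : Fintype G := Fintype.ofFinite G
  let e := Fintype.equivFin G
  let π : G →* GL (Fin (Fintype.card G)) ℂ :=
    ((Matrix.permMatrixHom (R := ℂ)).comp
      (e.permCongrHom.toMonoidHom.comp (MulAction.toPermHom G G))).toHomUnits
  have hπ : Function.Injective π := by
    intro g h hgh
    have h1 := congrArg Units.val hgh
    simp only [π, MonoidHom.coe_toHomUnits, MonoidHom.coe_comp, Function.comp_apply,
      Matrix.permMatrixHom_apply, MulEquiv.coe_toMonoidHom] at h1
    have h2 := PEquiv.toMatrix_injective h1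
    have h3 : e.permCongrHom (MulAction.toPermHom _ _ g) =
        e.permCongrHom (MulAction.toPermHom _ _ h) := by
      refine inv_injective (Equiv.ext fun x ↦ ?_)
      have hx := congrArg (fun f : PEquiv _ _ ↦ f x) h2
      simpa only [Equiv.toPEquiv_apply, Option.some.injEq] using hx
    exact MulAction.toPerm_injective (e.permCongrHom.injective h3)
  let S₀ : absoluteGaloisGroup K →* GL (Fin (Fintype.card G)) ℂ := π.comp (QuotientGroup.mk' _)
  have hker : ∀ σ, S₀ σ = 1 ↔ σ ∈ N.toSubgroup := by
    intro σ
    rw [← QuotientGroup.eq_one_iff, ← hπ.eq_iff, map_one]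
    rfl
  have hcont : Continuous S₀ := by
    refine continuous_of_continuousAt_one S₀ ?_
    rw [ContinuousAt, map_one]
    refine (tendsto_const_nhds (x := (1 : GL (Fin (Fintype.card G)) ℂ))).congr' ?_
    filter_upwards [N.isOpen.mem_nhds N.toSubgroup.one_mem] with σ hσ
    exact ((hker σ).2 hσ).symm
  refine ⟨Fintype.card G, ⟨S₀, hcont⟩, ?_⟩
  ext σ
  rw [MonoidHom.mem_ker]
  exact hker σ

end S4


/-! ### Places of `ℚ`, rational primes, and unramifiedness over `ℤ` versus `𝓞 ℚ` -/

section RatPlaces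

/-- The prime `p_v` below a finite place `v` of `ℚ` is the unique rational prime in `v`.
[folklore] -/
theorem Rat.natGenerator_eq_of_natCast_mem {l : ℕ} (hl : l.Prime) {v : HeightOneSpectrum (𝓞 ℚ)}
    (h : (l : 𝓞 ℚ) ∈ v.asIdeal) : natGenerator v = l :=
  (Nat.prime_dvd_prime_iff_eq (prime_natGenerator v) hl).1 ((Rat.natCast_mem_asIdeal_iff v).1 h)

/-- The finite places of `ℚ` containing a given rational prime form a subsingleton (hence finite)
set (cf. `Literature.NumberTheory.EllipticCurves.heightOneSpectrum_eq_of_natCast_mem`, the same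
uniqueness in the elliptic-curve files, not imported here). [folklore] -/
theorem Rat.finite_setOf_natCast_mem {l : ℕ} (hl : l.Prime) :
    {v : HeightOneSpectrum (𝓞 ℚ) | (l : 𝓞 ℚ) ∈ v.asIdeal}.Finite :=
  Set.Subsingleton.finite fun _ h _ h' ↦ Rat.natGenerator_injective
    ((Rat.natGenerator_eq_of_natCast_mem hl h).trans (Rat.natGenerator_eq_of_natCast_mem hl h').symm)

variable {F : Type*} [Field F] [NumberField F]

/-- A prime of `𝓞 F` containing the rational prime `l` lies over the place `(l)` of `ℚ`. [folklore] -/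
theorem Rat.under_eq_asIdeal_of_natCast_mem {l : ℕ} (hl : l.Prime) {v : HeightOneSpectrum (𝓞 ℚ)}
    (hlv : (l : 𝓞 ℚ) ∈ v.asIdeal) {𝔓 : Ideal (𝓞 F)} [𝔓.IsPrime] (h𝔓 : (l : 𝓞 F) ∈ 𝔓) :
    𝔓.under (𝓞 ℚ) = v.asIdeal := by
  have hmem : (l : 𝓞 ℚ) ∈ 𝔓.under (𝓞 ℚ) := by
    rw [Ideal.under_def, Ideal.mem_comap, map_natCast]; exact h𝔓
  have hne : 𝔓.under (𝓞 ℚ) ≠ ⊥ := fun h0 ↦ by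
    rw [h0, Ideal.mem_bot, Nat.cast_eq_zero] at hmem
    exact hl.ne_zero hmem
  set v' : HeightOneSpectrum (𝓞 ℚ) := ⟨𝔓.under (𝓞 ℚ), inferInstance, hne⟩ with hv'
  have : v' = v := Rat.natGenerator_injective
    ((Rat.natGenerator_eq_of_natCast_mem hl (v := v') hmem).trans
      (Rat.natGenerator_eq_of_natCast_mem hl hlv).symm)
  exact congrArg HeightOneSpectrum.asIdeal this

/-- **Unramified over `𝓞 ℚ` at `(l)` implies unramified over `ℤ` at `(l)`** (`e(𝔓 | ℤ) =
e(𝔓 ∩ 𝓞 ℚ | ℤ) · e(𝔓 | 𝓞 ℚ)`, Mathlib `Ideal.ramificationIdx_tower`, and `ℚ` has discriminant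
`1`). [folklore] -/
theorem Rat.isUnramifiedIn_int_of_isUnramifiedIn {l : ℕ} (hl : l.Prime)
    {v : HeightOneSpectrum (𝓞 ℚ)} (hlv : (l : 𝓞 ℚ) ∈ v.asIdeal)
    (hunr : Algebra.IsUnramifiedIn (𝓞 F) v.asIdeal) :
    Algebra.IsUnramifiedIn (𝓞 F) (Ideal.span {(l : ℤ)}) := by
  rw [Algebra.isUnramifiedIn_iff_forall_of_isDedekindDomain]
  intro 𝔓 hmax hlies
  haveI := hmax
  have hl𝔓 : (l : 𝓞 F) ∈ 𝔓 := by
    have : (l : ℤ) ∈ 𝔓.under ℤ := by rw [← hlies.over]; exact Ideal.mem_span_singleton_self _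
    rw [Ideal.under_def, Ideal.mem_comap, map_natCast] at this
    exact this
  have hunder : 𝔓.under (𝓞 ℚ) = v.asIdeal := Rat.under_eq_asIdeal_of_natCast_mem hl hlv hl𝔓
  haveI : Algebra.IsUnramifiedAt (𝓞 ℚ) 𝔓 := hunr 𝔓 hmax.isPrime ⟨hunder.symm⟩
  haveI : (𝔓.under (𝓞 ℚ)).IsMaximal := by rw [hunder]; exact v.isMaximal
  have h2 : Algebra.IsUnramifiedAt ℤ (𝔓.under (𝓞 ℚ)) := by
    have hdisc : ¬ (l : ℤ) ∣ NumberField.discr ℚ := by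
      rw [NumberField.discr_rat]
      exact fun h ↦ hl.one_lt.ne' (by exact_mod_cast Int.eq_one_of_dvd_one (Int.natCast_nonneg l) h)
    have := (NumberField.not_dvd_discr_iff_isUnramifiedIn ℚ (𝓞 ℚ)
      (Nat.prime_iff_prime_int.mp hl)).mp hdisc
    rw [Algebra.isUnramifiedIn_iff_forall_of_isDedekindDomain] at this
    refine this _ inferInstance ⟨?_⟩
    rw [Ideal.under_under]
    exact hlies.over
  have e1 : 𝔓.ramificationIdx (𝓞 ℚ) = 1 := Ideal.ramificationIdx_eq_one 𝔓 (𝓞 ℚ)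
  have e2 : (𝔓.under (𝓞 ℚ)).ramificationIdx ℤ = 1 := Ideal.ramificationIdx_eq_one _ ℤ
  have e3 := Ideal.ramificationIdx_tower (R := ℤ) (𝔓.under (𝓞 ℚ)) 𝔓
  rw [e1, e2] at e3
  exact Ideal.ramificationIdx_eq_one_iff.mp e3

end RatPlaces

/-! ### A Frobenius fixing `μ_p` has residue characteristic `≡ 1 (mod p)` -/

section RootsOfUnity

variable {K : Type u} [Field K] [NumberField K]

/-- **A Frobenius fixing the `p`-th roots of unity has residue characteristic `≡ 1 mod p`.**  If
`Φ ∈ Γ_K` is an arithmetic Frobenius at a prime `𝔓` of `\bar ℤ_K` above the place `v ∤ p` and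
`Φ ∈ Γ_{K(ζ_p)}`, then `q_v ≡ 1 (mod p)`: a primitive `p`-th root of unity `ζ ∈ \bar ℤ_K` has
`Φ ζ = ζ^{q_v}` (Mathlib `IsArithFrobAt.apply_of_pow_eq_one`, as `p ∉ 𝔓`) and `Φ ζ = ζ`, so
`ζ^{q_v - 1} = 1`.  (Source: "Since `τ` fixes `F(ζ_p)`, we have `l ≡ 1 mod p`.") [folklore] -/
theorem residueCard_modEq_one_of_isArithFrobAt_of_mem {p : ℕ} (hp : p.Prime)
    {v : HeightOneSpectrum (𝓞 K)} (hpv : (p : 𝓞 K) ∉ v.asIdeal)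
    {𝔓 : Ideal (absIntegers (𝓞 K) K)} (h𝔓 : 𝔓 ∈ v.primesAbove)
    {Φ : absoluteGaloisGroup K} (hΦ : IsArithFrobAt (𝓞 K) Φ 𝔓)
    (hΦ1 : Φ ∈ absGaloisGroupAdjoinRootsOfUnity K p) :
    v.residueCard ≡ 1 [MOD p] := by
  haveI : NeZero p := ⟨hp.ne_zero⟩
  haveI : NeZero ((p : ℕ) : AlgebraicClosure K) := NeZero.charZero
  obtain ⟨ζ, hζ⟩ : ∃ ζ : AlgebraicClosure K, IsPrimitiveRoot ζ p := HasEnoughRootsOfUnity.prim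
  have hζint : IsIntegral (𝓞 K) ζ :=
    IsIntegral.of_pow hp.pos (by rw [hζ.pow_eq_one]; exact isIntegral_one)
  set z : absIntegers (𝓞 K) K := ⟨ζ, hζint⟩ with hz
  have hzp : z ^ p = 1 := Subtype.ext (by rw [SubmonoidClass.coe_pow]; exact hζ.pow_eq_one)
  have hpP : ((p : ℕ) : absIntegers (𝓞 K) K) ∉ 𝔓 := by
    intro h
    apply hpv
    have : ((p : ℕ) : 𝓞 K) ∈ 𝔓.under (𝓞 K) := by
      rw [Ideal.under_def, Ideal.mem_comap, map_natCast]; exact h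
    rw [h𝔓.2.over]
    exact this
  -- `Φ z = z ^ q_v` and `Φ z = z`
  have h1 : Φ • z = z ^ v.residueCard := by
    have := hΦ.apply_of_pow_eq_one hzp hpP
    rwa [HeightOneSpectrum.card_quotient_under_eq_residueCard h𝔓] at this
  have h2 : Φ • z = z := by
    apply Subtype.ext
    rw [mem_absGaloisGroupAdjoinRootsOfUnity_iff] at hΦ1
    exact hΦ1 ζ hζ.pow_eq_one
  have hq1 : 1 ≤ v.residueCard := v.one_lt_residueCard.le
  have h3 : ζ ^ (v.residueCard - 1) = 1 := by
    have hz0 : z ≠ 0 := fun h0 ↦ by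
      have := congrArg (fun x : absIntegers (𝓞 K) K ↦ (x : AlgebraicClosure K)) h0
      exact hζ.ne_zero hp.ne_zero this
    have : z ^ (v.residueCard - 1) * z = 1 * z := by
      rw [← pow_succ, Nat.sub_add_cancel hq1, ← h1, h2, one_mul]
    have h4 : z ^ (v.residueCard - 1) = 1 := mul_right_cancel₀ hz0 this
    have := congrArg (fun x : absIntegers (𝓞 K) K ↦ (x : AlgebraicClosure K)) h4
    simpa using this
  have hdvd : p ∣ v.residueCard - 1 := hζ.dvd_of_pow_eq_one _ h3
  exact ((Nat.modEq_iff_dvd' hq1).2 hdvd).symm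

end RootsOfUnity


/-! ### Caraiani–Newton, Lemma 6.2.2 -/

section Main

open CaraianiNewton

/-- **Caraiani–Newton (2023), Lemma 6.2.2 — PROVED.** *"Let `F/ℚ` be a quadratic field, let `p`
be an odd prime, and let `ρ̄ : G_F → GL₂(𝔽_p)` be a homomorphism. Suppose that `ρ̄|_{G_{F(ζ_p)}}`
is absolutely irreducible. Then `ρ̄` is decomposed generic."*  Rendering: `F` a number field with
`[F : ℚ] = 2`; `p` prime, `p ≠ 2`; `ρ̄ : Γ_F →ₜ* GL₂(𝔽_p)` continuous (`ModPGaloisRep`; in the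
source continuity is implicit — `ρ̄ = r̄_{E,p}`); hypothesis as in
`ModPImageAbsIrreducibleOverCyclotomic`: for every model `L ⊇ F` of `F(ζ_p)`
(`IsCyclotomicExtension {p} F L`) the restriction `ρ̄|_{Γ_L}` is absolutely irreducible;
conclusion `IsDecomposedGeneric ρ̄` ([ACC⁺23, Def. 4.3.1] as used in the source, §1.5): some
rational prime `l ≠ p` splits completely in `F` and at every place `w ∣ l` of `F` the
representation `ρ̄` is unramified with Frobenius eigenvalues `α₁ ≠ α₂`, `α_i ≠ l α_j`.  Proof: see
the module docstring (the printed proof, with the tree's proved Chebotarev theorem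
`chebotarev_artinRep_holds` and the group-theoretic heart
`CaraianiNewton.exists_disc_ne_zero_and_disc_apply_ne_zero`).
[cite: CaraianiNewton2023, Lemma 6.2.2 (p. 90; proof pp. 90–91)] -/
theorem isDecomposedGeneric_of_isAbsolutelyIrreducible_restrictField_cyclotomic
    (F : Type) [Field F] [NumberField F] (hF2 : Module.finrank ℚ F = 2)
    (p : ℕ) [Fact p.Prime] (hp2 : p ≠ 2) (ρ : ModPGaloisRep F (ZMod p) 2)
    (hirr : ∀ (L : Type) [Field L] [Algebra F L] [IsCyclotomicExtension {p} F L],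
      FramedRep.IsAbsolutelyIrreducible (FramedGaloisRep.restrictField L ρ)) :
    IsDecomposedGeneric (ρ : absoluteGaloisGroup F →* GL (Fin 2) (ZMod p)) := by
  classical
  have hp : p.Prime := Fact.out
  set ρ₀ := (ρ : absoluteGaloisGroup F →* GL (Fin 2) (ZMod p)) with hρ₀
  haveI : Algebra.IsQuadraticExtension ℚ F := ⟨hF2⟩
  haveI : IsGalois ℚ F := inferInstance
  haveI : NeZero ((p : ℕ) : F) := NeZero.charZero
  /- Step 1: `Γ₁ = Γ_{F(ζ_p)}` and irreducibility of `ρ̄` on it. -/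
  set Γ₁ : Subgroup (absoluteGaloisGroup F) := absGaloisGroupAdjoinRootsOfUnity F p with hΓ₁
  have hirr₁ : (glRepresentation (ρ₀.comp Γ₁.subtype)).IsIrreducible := by
    have hL := hirr (CyclotomicField p F)
    rw [FramedRep.isAbsolutelyIrreducible_iff_coe] at hL
    have hcoe : ((FramedGaloisRep.restrictField (CyclotomicField p F) ρ :
        FramedGaloisRep (CyclotomicField p F) (ZMod p) 2) :
          absoluteGaloisGroup (CyclotomicField p F) →* GL (Fin 2) (ZMod p)) =
        ρ₀.comp (absGaloisRestrict F (CyclotomicField p F)).toMonoidHom := rfl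
    rw [hcoe] at hL
    refine isIrreducible_glRepresentation_of_range_le hL.isIrreducible (le_of_eq ?_)
    rw [MonoidHom.range_comp, MonoidHom.range_comp, Subgroup.range_subtype]
    congr 1
    exact range_absGaloisRestrict_eq_absGaloisGroupAdjoinRootsOfUnity F (CyclotomicField p F) p
  /- Step 2: `res : Γ_F → Γ_ℚ`, its image `H` (open, normal, index two), `c ∉ H`, `θ = θ_c`. -/
  set res := absGaloisRestrict ℚ F with hres
  obtain ⟨hHopen, hHi⟩ := Automorphic.isOpen_range_absGaloisRestrict_and_index_eq_two ℚ F hF2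
  have hHn : ((absGaloisRestrict ℚ F).range : Subgroup (absoluteGaloisGroup ℚ)).Normal :=
    normal_range_absGaloisRestrict ℚ F
  set H : Subgroup (absoluteGaloisGroup ℚ) := (absGaloisRestrict ℚ F).range with hH
  obtain ⟨c, hc⟩ : ∃ c : absoluteGaloisGroup ℚ, c ∉ H := by
    by_contra! hall
    have htop : H = ⊤ := eq_top_iff.2 fun x _ ↦ hall x
    rw [htop, Subgroup.index_top] at hHi
    exact absurd hHi (by decide)
  set θ := absGaloisOuterConj ℚ F c with hθ
  have hθΓ₁ : Γ₁.map θ.toMonoidHom = Γ₁ :=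
    map_absGaloisOuterConj_absGaloisGroupAdjoinRootsOfUnity ℚ F p c
  have hresθ : ∀ σ, res (θ σ) = c * res σ * c⁻¹ := absGaloisRestrict_absGaloisOuterConj ℚ F c
  /- Step 3: the group-theoretic heart: `τ ∈ Γ₁` with `ρ̄(τ)`, `ρ̄(θ τ)` regular semisimple. -/
  obtain ⟨τ, hτ₁, hd1, hd2⟩ :=
    exists_disc_ne_zero_and_disc_apply_ne_zero hp2 ρ₀ θ.toMonoidHom Γ₁ hθΓ₁ hirr₁
  /- Step 4: an open normal subgroup `N ≤ res(ker ρ̄ ∩ Γ₁)` of `Γ_ℚ` and a faithful Artin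
  representation `S` of `Γ_ℚ / N`. -/
  have hker : IsOpen ((ρ₀.ker : Subgroup (absoluteGaloisGroup F)) : Set (absoluteGaloisGroup F)) := by
    have e : ((ρ₀.ker : Subgroup (absoluteGaloisGroup F)) : Set (absoluteGaloisGroup F)) =
        ρ ⁻¹' {1} := by
      ext; simp [MonoidHom.mem_ker, hρ₀]
    rw [e]
    exact (isOpen_discrete _).preimage ρ.continuous
  have hΓ₁open : IsOpen (Γ₁ : Set (absoluteGaloisGroup F)) :=
    isOpen_absGaloisGroupAdjoinRootsOfUnity F p hp.pos
  set U : Set (absoluteGaloisGroup ℚ) :=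
    res '' (((ρ₀.ker : Subgroup (absoluteGaloisGroup F)) : Set (absoluteGaloisGroup F)) ∩
      (Γ₁ : Set (absoluteGaloisGroup F))) with hU
  have hUopen : IsOpen U :=
    isOpenMap_absGaloisRestrict_of_isOpen_range ℚ F hHopen _ (hker.inter hΓ₁open)
  have h1U : (1 : absoluteGaloisGroup ℚ) ∈ U := ⟨1, ⟨ρ₀.ker.one_mem, Γ₁.one_mem⟩, map_one _⟩
  obtain ⟨N, hNU⟩ := ProfiniteGrp.exist_openNormalSubgroup_sub_open_nhds_of_one hUopen h1U
  have hN : ∀ n ∈ N.toSubgroup, ∃ n' : absoluteGaloisGroup F, ρ₀ n' = 1 ∧ n' ∈ Γ₁ ∧ res n' = n := by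
    intro n hn
    obtain ⟨n', ⟨h1, h2⟩, h3⟩ := hNU hn
    exact ⟨n', h1, h2, h3⟩
  have hNH : N.toSubgroup ≤ H := fun n hn ↦ by
    obtain ⟨n', -, -, rfl⟩ := hN n hn
    exact ⟨n', rfl⟩
  obtain ⟨m, S, hSker⟩ := exists_framedArtinRep_ker_eq N
  have hSN : ∀ g : absoluteGaloisGroup ℚ, S g = 1 ↔ g ∈ N.toSubgroup := fun g ↦ by
    rw [← hSker, MonoidHom.mem_ker]
    rfl
  /- Step 5: Chebotarev over `ℚ` at `g = res τ`, away from the finitely many places of `ℚ` that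
  ramify in `F` or lie over `p`. -/
  have hCheb := Automorphic.chebotarev_artinRep_holds ℚ m S (res τ)
  have hbad : ({v : HeightOneSpectrum (𝓞 ℚ) | ¬ Algebra.IsUnramifiedIn (𝓞 F) v.asIdeal} ∪
      {v : HeightOneSpectrum (𝓞 ℚ) | ((p : ℕ) : 𝓞 ℚ) ∈ v.asIdeal}).Finite :=
    (finite_setOf_not_isUnramifiedIn ℚ F).union (Rat.finite_setOf_natCast_mem hp)
  obtain ⟨v, ⟨hSunr, 𝔓₀, h𝔓₀, Φ, hΦ, hSΦ⟩, hvbad⟩ := (hCheb.sdiff hbad).nonempty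
  simp only [Set.mem_union, Set.mem_setOf_eq, not_or, not_not] at hvbad
  obtain ⟨hunr, hpv⟩ := hvbad
  -- the rational prime `l` below `v`
  set l : ℕ := natGenerator v with hl
  have hlprime : l.Prime := prime_natGenerator v
  have hlv : (l : 𝓞 ℚ) ∈ v.asIdeal := (Rat.natCast_mem_asIdeal_iff v).2 dvd_rfl
  have hlp : l ≠ p := fun h ↦ hpv (h ▸ hlv)
  have hql : v.residueCard = l := Rat.residueCard_eq_natGenerator v
  -- `Φ ≡ res τ (mod N)`, so `Φ ∈ H` and `Φ ∈ Γ_{ℚ(ζ_p)}`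
  have hΦN : (res τ)⁻¹ * Φ ∈ N.toSubgroup := by
    rw [← hSN, map_mul, map_inv, hSΦ, inv_mul_cancel]
  have hΦeq : Φ = res τ * ((res τ)⁻¹ * Φ) := by group
  have hΦH : Φ ∈ H := by
    rw [hΦeq]
    exact H.mul_mem ⟨τ, rfl⟩ (hNH hΦN)
  have hΦ1 : Φ ∈ absGaloisGroupAdjoinRootsOfUnity ℚ p := by
    have h1 : res τ ∈ absGaloisGroupAdjoinRootsOfUnity ℚ p :=
      (mem_absGaloisGroupAdjoinRootsOfUnity_iff_absGaloisRestrict ℚ F p τ).1 hτ₁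
    obtain ⟨n', -, hn'1, hn'⟩ := hN _ hΦN
    have h2 : (res τ)⁻¹ * Φ ∈ absGaloisGroupAdjoinRootsOfUnity ℚ p := by
      rw [← hn']
      exact (mem_absGaloisGroupAdjoinRootsOfUnity_iff_absGaloisRestrict ℚ F p n').1 hn'1
    rw [hΦeq]
    exact Subgroup.mul_mem _ h1 h2
  -- `l ≡ 1 (mod p)`
  have hl1 : l ≡ 1 [MOD p] := by
    have := residueCard_modEq_one_of_isArithFrobAt_of_mem hp hpv h𝔓₀ hΦ hΦ1
    rwa [hql] at this
  have hlcast : ((l : ℕ) : AlgebraicClosure (ZMod p)) = 1 :=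
    natCast_algebraicClosure_eq_one_of_modEq hl1
  -- residue degree one above `v` (the places of `F` above `l` split)
  have hfin2 : (Module.finrank ℚ F).Prime := by rw [hF2]; exact Nat.prime_two
  obtain ⟨-, -, -, -, hf1, -, -⟩ := exists_places_split_of_mem_range (F := ℚ) (M := F) hfin2 hHn
    (hHi.trans hF2.symm) hc hunr h𝔓₀ hΦ hΦH
  have hwv : ∀ w : HeightOneSpectrum (𝓞 F), ((l : ℕ) : 𝓞 F) ∈ w.asIdeal →
      w.asIdeal.under (𝓞 ℚ) = v.asIdeal := fun w hw ↦
    haveI := w.isPrime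
    Rat.under_eq_asIdeal_of_natCast_mem hlprime hlv hw
  have hf : ∀ w : HeightOneSpectrum (𝓞 F), ((l : ℕ) : 𝓞 F) ∈ w.asIdeal →
      w.asIdeal.inertiaDeg (𝓞 ℚ) = 1 := fun w hw ↦
    hf1 w (HeightOneSpectrum.ext (by rw [HeightOneSpectrum.under_asIdeal]; exact hwv w hw))
  have hqw : ∀ w : HeightOneSpectrum (𝓞 F), ((l : ℕ) : 𝓞 F) ∈ w.asIdeal → w.residueCard = l := by
    intro w hw
    rw [residueCard_eq_residueCard_pow_inertiaDeg (hwv w hw), hf w hw, pow_one, hql]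
  /- Step 6: `l` is decomposed generic for `ρ̄`. -/
  refine ⟨l, hlprime, ?_, ?_, fun w hw ↦ ⟨fun 𝔔 h𝔔 g hg ↦ ?_, fun 𝔔 h𝔔 φ hφ ↦ ?_⟩⟩
  · -- `l ≠ char 𝔽_p`
    rw [ZMod.ringChar_zmod_n]
    exact hlp
  · -- `l` splits completely in `F`
    exact ⟨Rat.isUnramifiedIn_int_of_isUnramifiedIn hlprime hlv hunr, fun w hw ↦ hqw w hw⟩
  · -- `ρ̄` is unramified at `w ∣ l`: inertia maps into inertia over `ℚ`, killed by `S`, so lies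
    -- in `N ≤ res(ker ρ̄)`
    have h1 : res g ∈ (𝔔.comap (absIntegersMap ℚ F)).inertia (absoluteGaloisGroup ℚ) :=
      absGaloisRestrict_mem_inertia_comap ℚ F hg
    have h2 : 𝔔.comap (absIntegersMap ℚ F) ∈ v.primesAbove :=
      comap_absIntegersMap_mem_primesAbove (hwv w hw) h𝔔
    have h3 : S (res g) = 1 := hSunr _ h2 _ h1
    obtain ⟨n', hn'1, -, hn'⟩ := hN _ ((hSN _).1 h3)
    rw [← absGaloisRestrict_injective ℚ F hn']
    exact hn'1
  · -- Frobenius elements at `w ∣ l` are `ρ̄`-conjugate to `ρ̄(τ)` or `ρ̄(θ τ)`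
    have hresφ : IsArithFrobAt (𝓞 ℚ) (res φ) (𝔔.comap (absIntegersMap ℚ F)) :=
      isArithFrobAt_absGaloisRestrict_of_inertiaDeg_eq_one (hwv w hw) h𝔔 hφ (hf w hw)
    set 𝔓₁ := 𝔔.comap (absIntegersMap ℚ F) with h𝔓₁def
    have h𝔓₁ : 𝔓₁ ∈ v.primesAbove := comap_absIntegersMap_mem_primesAbove (hwv w hw) h𝔔
    obtain ⟨γ, hγ⟩ := HeightOneSpectrum.exists_smul_eq_of_mem_primesAbove_holds h𝔓₀ h𝔓₁
    have hΦ' : IsArithFrobAt (𝓞 ℚ) (γ * Φ * γ⁻¹) 𝔓₁ := hγ ▸ hΦ.conj γ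
    have hin : res φ * (γ * Φ * γ⁻¹)⁻¹ ∈ 𝔓₁.inertia (absoluteGaloisGroup ℚ) :=
      hresφ.mul_inv_mem_inertia hΦ'
    have hS1 : S (res φ * (γ * Φ * γ⁻¹)⁻¹) = 1 := hSunr _ h𝔓₁ _ hin
    have hmodN : res φ * (γ * res τ * γ⁻¹)⁻¹ ∈ N.toSubgroup := by
      rw [← hSN]
      have e : S (γ * Φ * γ⁻¹) = S (γ * res τ * γ⁻¹) := by simp only [map_mul, map_inv, hSΦ]
      rw [map_mul, map_inv, ← e, ← map_inv, ← map_mul]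
      exact hS1
    obtain ⟨n', hn'1, -, hn'⟩ := hN _ hmodN
    -- coset decomposition `γ = h cⁱ`, `h = res h'`, `i < 2`
    obtain ⟨i, hi, h, hhH, hγeq⟩ := exists_mem_mul_pow_eq_of_prime_index Nat.prime_two hHi hc γ
    obtain ⟨h', rfl⟩ := hhH
    change γ = res h' * c ^ i at hγeq
    have key : ∃ (g : GL (Fin 2) (ZMod p)) (x : absoluteGaloisGroup F),
        (g = ρ₀ τ ∨ g = ρ₀ (θ τ)) ∧ ρ₀ φ = ρ₀ x * g * (ρ₀ x)⁻¹ := by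
      have hφn : res φ = res n' * (γ * res τ * γ⁻¹) := by
        rw [hn', inv_mul_cancel_right]
      interval_cases i
      · refine ⟨ρ₀ τ, h', Or.inl rfl, ?_⟩
        have e : res φ = res (n' * (h' * τ * h'⁻¹)) := by
          rw [hφn, hγeq, pow_zero, mul_one, map_mul, map_mul, map_mul, map_inv]
        rw [absGaloisRestrict_injective ℚ F e, map_mul, hn'1, one_mul, map_mul, map_mul, map_inv]
      · refine ⟨ρ₀ (θ τ), h', Or.inr rfl, ?_⟩
        have e : res φ = res (n' * (h' * θ τ * h'⁻¹)) := by
          rw [hφn, hγeq, pow_one, map_mul, map_mul, map_mul, map_inv, hresθ]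
          group
        rw [absGaloisRestrict_injective ℚ F e, map_mul, hn'1, one_mul, map_mul, map_mul, map_inv]
    obtain ⟨g, x, hg, hφx⟩ := key
    have hdisc : ((g : GL (Fin 2) (ZMod p)) : Matrix (Fin 2) (Fin 2) (ZMod p)).trace ^ 2 -
        4 * ((g : GL (Fin 2) (ZMod p)) : Matrix (Fin 2) (Fin 2) (ZMod p)).det ≠ 0 := by
      rcases hg with rfl | rfl
      · exact hd1
      · exact hd2
    rw [show (ρ : absoluteGaloisGroup F →* GL (Fin 2) (ZMod p)) φ = ρ₀ φ from rfl, hφx,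
      eigenvalueMultiset_conj, hqw w hw]
    exact ⟨nodup_eigenvalueMultiset_of_disc_ne_zero g hdisc, ne_mul_of_cast_eq_one hlcast _⟩

end Main

end Literature.NumberTheory.GaloisRepresentations
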